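import Literature.MathematicalPhysics.MHD.SolovevSafetyFactorMonotone
import Summits.Ventures.FusionMHD.Models.SolovevPCFSafetyFactorProfile
import HarnessLib

/-!
# Ventures/FusionMHD — Models/SolovevPCFSafetyFactorMonotone.lean: «q > 1 ON EVERY FLUX SURFACE» and positive shear for the
# F1.a analytic equilibria of record (ITER-like / NSTX-like PCF Solov'ev), F-parametric, no numerics

HONEST FRAMING (LADDER-GRIDFUSION three columns). MODELLED: ideal MHD, axisymmetric, Solov'ev profiles (`μ₀p′ = −1`,
`FF′ = 0`), analytic fixed-boundary PCF equilibria `Models/SolovevPCF` (Pataki–Cerfon–Freidberg 2013 §6.1); the free constant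
`F = RB_φ` is a parameter. CERTIFIED (kernel, this file; exact, numerics-free): on EVERY flux surface of the typed
equilibrium — the printed Lee–Cerfon loops `lcLoop R_a κ₀ r`, `0 < r < R_a/2` (they trace the level sets `{Ψ = Ψ_s} ∩ {R > 0}`,
model-5's `SolovevFluxSurfaceLoopTrace`), which include all plasma surfaces `0 < r ≤ a = ε/R_a` — Freidberg's safety factor
(6.35) (`GradShafranov.safetyFactorE`, Euclidean arc length) satisfies
* `q0_lt_safetyFactorE_surface` — `q(r) > q₀(F)` (`F > 0`);
* **`one_lt_safetyFactorE_surface`** — **`q(r) > 1` for every `F ≥ F_min`** (`F_min = 2511/5000` ITER-like, `2031/2500`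
  NSTX-like: the certified on-axis thresholds of `Models/SolovevPCF.q0_ge_one`, p463504) — the whole-PROFILE form of the
  Kruskal–Shafranov-type inequality `q > 1`, upgrading the on-axis row F1.a(a) and the edge rows F1.QEDGE;
* `strictMonoOn_safetyFactorE_surface` — POSITIVE SHEAR: `r ↦ q(r)` strictly increasing on `(0, R_a/2)`
  (`deriv_safetyFactorE_surface_pos`: `dq/dr > 0`).
Method (Literature `SolovevSafetyFactorMonotone.lean`, sos-6 g3): reflection `t ↦ π − t` on the printed loop + the supporting
line of `x^{-3/2}`; model-5's `safetyFactorE_lcLoop` / `hasDerivAt_safetyFactorE_lcLoop` / `psi_eq_psiLC`. VALIDATED: nothing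
needed. Nothing here says a plasma or device is stable (`q > 1` is a NECESSARY-type kink/sawtooth criterion of the MODEL).
Cell `gridfusion`, seat `gridfusion-sos-6` (g3), 2026-08-27. [cite: PatakiCerfonFreidberg2013, §6.1] [cite: Freidberg2014, §6.3.5 eq. (6.35)]
-/

noncomputable section

namespace Summit.Ventures.FusionMHD.Models.SolovevPCF

open Literature.MathematicalPhysics.MHD Literature.MathematicalPhysics.MHD.GradShafranov
  Literature.MathematicalPhysics.MHD.Solovev _root_.Real _root_.Set

namespace IterLike

/-- **`q > q₀` on every flux surface (ITER-like):** for `F > 0` and `0 < r < R_a/2`,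
`q₀(F) < safetyFactorE F Ψ (lcLoop R_a κ₀ r) (2π)`. -/
theorem q0_lt_safetyFactorE_surface {F r : ℝ} (hF : 0 < F) (hr : 0 < r) (h2r : 2 * r < Ra) :
    q0 F < safetyFactorE F psi (lcLoop Ra kappa0 r) (2 * π) := by
  rw [psi_eq_psiLC hF.ne']
  exact q0_lt_safetyFactorE_lcLoop Ra_pos kappa0_pos hF (q0_pos hF) hr h2r _

/-- **KRUSKAL–SHAFRANOV-TYPE `q > 1` ON EVERY FLUX SURFACE (ITER-like), F-parametric:** for every `F ≥ F_min = 2511/5000`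
and every surface `0 < r < R_a/2`, `1 < safetyFactorE F Ψ (lcLoop R_a κ₀ r) (2π)`. -/
theorem one_lt_safetyFactorE_surface {F r : ℝ} (hF : Fmin ≤ F) (hr : 0 < r) (h2r : 2 * r < Ra) :
    1 < safetyFactorE F psi (lcLoop Ra kappa0 r) (2 * π) := by
  have hFpos : 0 < F := lt_of_lt_of_le (by unfold Fmin; norm_num) hF
  exact lt_of_le_of_lt (q0_ge_one hF) (q0_lt_safetyFactorE_surface hFpos hr h2r)

/-- The same on every PLASMA surface `0 < r ≤ a = ε/R_a` (the plasma edge label; `2a < R_a`). -/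
theorem one_lt_safetyFactorE_plasma {F r : ℝ} (hF : Fmin ≤ F) (hr : 0 < r) (hra : r ≤ ε / Ra) :
    1 < safetyFactorE F psi (lcLoop Ra kappa0 r) (2 * π) :=
  one_lt_safetyFactorE_surface hF hr (lt_of_le_of_lt (by linarith) edge_minorRadius.2)

/-- **Positive shear (ITER-like):** `dq/dr > 0` on every surface `0 < r < R_a/2` (`F > 0`). -/
theorem deriv_safetyFactorE_surface_pos {F r : ℝ} (hF : 0 < F) (hr : 0 < r) (h2r : 2 * r < Ra) :
    0 < deriv (fun ρ => safetyFactorE F psi (lcLoop Ra kappa0 ρ) (2 * π)) r := by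
  rw [psi_eq_psiLC hF.ne']
  exact deriv_safetyFactorE_lcLoop_pos Ra_pos kappa0_pos hF (q0_pos hF) hr h2r _

/-- **The q-profile is strictly increasing outward (ITER-like):** for `F > 0`, `r ↦ safetyFactorE F Ψ (lcLoop R_a κ₀ r) (2π)`
is strictly monotone on `(0, R_a/2)`. -/
theorem strictMonoOn_safetyFactorE_surface {F : ℝ} (hF : 0 < F) :
    StrictMonoOn (fun ρ => safetyFactorE F psi (lcLoop Ra kappa0 ρ) (2 * π)) (Ioo 0 (Ra / 2)) := by
  rw [psi_eq_psiLC hF.ne']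
  exact strictMonoOn_safetyFactorE_lcLoop Ra_pos kappa0_pos hF (q0_pos hF) _

end IterLike

namespace NstxLike

/-- **`q > q₀` on every flux surface (NSTX-like):** for `F > 0` and `0 < r < R_a/2`,
`q₀(F) < safetyFactorE F Ψ (lcLoop R_a κ₀ r) (2π)`. -/
theorem q0_lt_safetyFactorE_surface {F r : ℝ} (hF : 0 < F) (hr : 0 < r) (h2r : 2 * r < Ra) :
    q0 F < safetyFactorE F psi (lcLoop Ra kappa0 r) (2 * π) := by
  rw [psi_eq_psiLC hF.ne']
  exact q0_lt_safetyFactorE_lcLoop Ra_pos kappa0_pos hF (q0_pos hF) hr h2r _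

/-- **KRUSKAL–SHAFRANOV-TYPE `q > 1` ON EVERY FLUX SURFACE (NSTX-like), F-parametric:** for every `F ≥ F_min = 2031/2500`
and every surface `0 < r < R_a/2`, `1 < safetyFactorE F Ψ (lcLoop R_a κ₀ r) (2π)`. -/
theorem one_lt_safetyFactorE_surface {F r : ℝ} (hF : Fmin ≤ F) (hr : 0 < r) (h2r : 2 * r < Ra) :
    1 < safetyFactorE F psi (lcLoop Ra kappa0 r) (2 * π) := by
  have hFpos : 0 < F := lt_of_lt_of_le (by unfold Fmin; norm_num) hF
  exact lt_of_le_of_lt (q0_ge_one hF) (q0_lt_safetyFactorE_surface hFpos hr h2r)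

/-- The same on every PLASMA surface `0 < r ≤ a = ε/R_a` (the plasma edge label; `2a < R_a`). -/
theorem one_lt_safetyFactorE_plasma {F r : ℝ} (hF : Fmin ≤ F) (hr : 0 < r) (hra : r ≤ ε / Ra) :
    1 < safetyFactorE F psi (lcLoop Ra kappa0 r) (2 * π) :=
  one_lt_safetyFactorE_surface hF hr (lt_of_le_of_lt (by linarith) edge_minorRadius.2)

/-- **Positive shear (NSTX-like):** `dq/dr > 0` on every surface `0 < r < R_a/2` (`F > 0`). -/
theorem deriv_safetyFactorE_surface_pos {F r : ℝ} (hF : 0 < F) (hr : 0 < r) (h2r : 2 * r < Ra) :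
    0 < deriv (fun ρ => safetyFactorE F psi (lcLoop Ra kappa0 ρ) (2 * π)) r := by
  rw [psi_eq_psiLC hF.ne']
  exact deriv_safetyFactorE_lcLoop_pos Ra_pos kappa0_pos hF (q0_pos hF) hr h2r _

/-- **The q-profile is strictly increasing outward (NSTX-like):** for `F > 0`, `r ↦ safetyFactorE F Ψ (lcLoop R_a κ₀ r) (2π)`
is strictly monotone on `(0, R_a/2)`. -/
theorem strictMonoOn_safetyFactorE_surface {F : ℝ} (hF : 0 < F) :
    StrictMonoOn (fun ρ => safetyFactorE F psi (lcLoop Ra kappa0 ρ) (2 * π)) (Ioo 0 (Ra / 2)) := by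
  rw [psi_eq_psiLC hF.ne']
  exact strictMonoOn_safetyFactorE_lcLoop Ra_pos kappa0_pos hF (q0_pos hF) _

end NstxLike

end Summit.Ventures.FusionMHD.Models.SolovevPCF

end
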